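import Summits.QuantumFields.YangMills.Theorems.BalabanUVNodesN19TiltedPriceInteriorBernstein

/-!
# YM-DAG node N19 (= NE7 proper) — THE INTERIOR PRICE FROM BELOW, module 3∕3: the interior price
# `ε·(log ε⁻¹∕log log ε⁻¹)∕√(l₀² − s²)` is ATTAINED at every interior source — Bernstein two-sided

Cell `pub-ymgap`, HUMAN RULING D-0062 (Track A), R141 (C) wider-strategy seat `pub-ymgap-dag-n19-e` (strategy s3 = ALTERNATIVE CURRENCY), generation
g16, module 3 of 3 (siblings: `…N19TiltedPriceInteriorWitness`, `…N19TiltedPriceInteriorBernstein` — the detuned grid-Chebyshev weights).  Route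
`Summits/QuantumFields/YangMills/Theses/BalabanUVNodes.lean` rev 23, cluster item K3⁶ «SpineGivenEndpointR13SepCoPR» (stmt-QuantumFields-20509); filed
`--supports` that item `--as helper` (it proves no registered stub).  COUNT-NEUTRAL: elementary probability over Mathlib (`Measure.tilted`, `mgf`, `cgf`)
and the seat's modules BY NAME — module 2 (`exists_expsum_witness_interior`), p510514 `…N19NoLinearPrice` (`exists_lawPair_of_weights`, `exp_neg_le_mgf_of_Icc`,
`ae_abs_le_one_of_Icc`, `abs_log_sub_log_le`), p517472 (`one_add_le_mul_log_of_le`), p528923 `…N19TiltedPrice` (`abs_tiltedMean_sub_le_sharp_of_cgf_close` —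
the upper half), p530176 (`integral_id_tilted_le_one`, `log_exp_one_add_posLog_le_two_mul`), tree `T4GenFunBounds`; NOT a discharge claim.

WHAT IT SAYS.  p528923 bounds the tilted-mean difference at an interior source `|s| < l₀` of two `[−B, B]`-bounded observables with cgf's `ε`-close on
`|u| ≤ l₀` by BERNSTEIN's `8e^{1+e(l₀+|s|)B}·ε·(1 + L₂)∕(√(l₀² − s²)·log(e + L₂))` (`≍ ε·n∕√(l₀² − s²)`, `n = log ε⁻¹∕log log ε⁻¹`).  HERE: this order is
attained at EVERY interior source, by module 2's detuned grid-Chebyshev pair.  §2 ★ `exists_cgf_close_tiltedMeans_far_interior`: as two probability laws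
on `[0, 1]` (p510514's `exists_lawPair_of_weights`) the cgf's are `e^{l₀}ε`-close on `|t| ≤ l₀` while
`|ΔtiltedMean(s)| ≥ e^{−l₀}·(M∕(32√(l₀² − s²)) − 1)·ε` — `Z_ν·Δ = D − ζ·(A_μ∕Z_μ)` with `D = Σ w_j(j∕M)e^{sj∕M}` (`|D| ≥ εM∕(32√(l₀² − s²))`),
`ζ = Z_ν − Z_μ = Σ w_j e^{sj∕M}` (`|ζ| ≤ ε`), `A_μ∕Z_μ ∈ [0, 1]` (§1), `Z_ν ≤ e^{l₀}`.  §3 ★★ `interior_price_two_sided`: for every `0 < l₀`, `|s| < l₀`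
and `ε₀ > 0` two laws on `[0, 1]` and `0 < ε ≤ ε₀` with cgf's `ε`-close on `|t| ≤ l₀` and
`c(l₀)·P(ε)∕√(l₀² − s²) ≤ |tiltedMean id ν s − tiltedMean id μ s| ≤ C(l₀)·P(ε)∕√(l₀² − s²)`, `P(ε) = ε·(1 + log⁺ε⁻¹)∕log(e + log⁺ε⁻¹)`, BOTH
CONSTANTS FREE OF `s`: `c(l₀) = e^{−2l₀}∕(64·(4 + log(1 + 4∕l₀)))`, `C(l₀) = 16e^{1+2e·l₀}` (lower: §2 at a large odd `M` + p517472's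
`1 + L ≤ (4 + log(1+4∕l₀))·M·log(e + L)`; upper: p528923 at `B = 1`, `c = 0`, `e^{e|s|} ≤ e^{e·l₀}`, + p530176's `log` trade).  With p516009∕p517472 (centre,
`n`), p528923∕p530176 (edge, `n²`) and p521610∕p524926 (outside, `T_n`) the DEGREE CURRENCY of the lineage is now typed TWO-SIDED EVERYWHERE.

KERNEL-CHECKED (0 `def`, 0 `sorry`): §1 `integral_id_tilted_nonneg`, `mgf_id_le_exp_of_Icc` · §2 ★ `exists_cgf_close_tiltedMeans_far_interior` · §3 ★★
`interior_price_two_sided`.  NOT claimed: optimal constants; uniformity of the witness `ε`-sequence in `s` (the statement is pointwise in `s`, as at the centre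
and at the edge).

HONEST FRAMING (binding).  Elementary; NO consumer in the DAG today; value = optimality certificate of p528923's interior Bernstein price.  Nothing of
[Balaban1987RG1]–[Balaban1989LargeFieldII] or [King1986] is asserted, quoted or instantiated; NE7 ∕ NE7b ∕ NE7c NOT PRINTED, NOT proved; N19 NOT discharged;
Track A count unmoved (typed 28∕28 · discharged 5∕27 · A 5∕28).  One finite `T⁴` programme at fixed `ε`; nothing continuum ∕ `ℝ⁴` ∕ OS ∕ mass-gap ∕ Clay.
THEOREMS ONLY; standard axioms; no cite tags.
-/

set_option autoImplicit false

noncomputable section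

open Real Finset MeasureTheory ProbabilityTheory

namespace Summit.QuantumFields.YangMills.Theorems.BalabanUVNodesN19TiltedPriceInteriorTwoSided

open Summit.QuantumFields.YangMills.Theorems.BalabanUVNodesN19NoLinearPrice
  (exists_lawPair_of_weights exp_neg_le_mgf_of_Icc ae_abs_le_one_of_Icc abs_log_sub_log_le)
open Summit.QuantumFields.YangMills.Theorems.BalabanUVNodesN19SharpPriceTwoSided (one_add_le_mul_log_of_le)
open Summit.QuantumFields.YangMills.Theorems.BalabanUVNodesN19TiltedPrice (abs_tiltedMean_sub_le_sharp_of_cgf_close)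
open Summit.QuantumFields.YangMills.Theorems.BalabanUVNodesN19TiltedPriceTwoSided
  (integral_id_tilted_le_one log_exp_one_add_posLog_le_two_mul)
open Summit.QuantumFields.YangMills.Theorems.BalabanUVNodesN19TiltedPriceInteriorBernstein (exists_expsum_witness_interior)
open Summit.QuantumFields.BalabanUV.T4Continuum.NE1p.DressedMGFForm (tiltedMean)

/-! ## §1 Two small facts about laws on `[0, 1]` [folklore] -/

/-- The mean of a law on `[0, 1]` under any of its tilts is nonnegative. [folklore] -/
theorem integral_id_tilted_nonneg {μ : Measure ℝ} (hμ : μ (Set.Icc 0 1)ᶜ = 0) (f : ℝ → ℝ) :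
    0 ≤ ∫ x, x ∂(μ.tilted f) := by
  have h : ∀ᵐ x ∂μ, x ∈ Set.Icc (0 : ℝ) 1 := by
    rw [ae_iff]
    simpa only [Set.mem_Icc, Set.compl_def] using hμ
  have h2 : ∀ᵐ x ∂(μ.tilted f), x ∈ Set.Icc (0 : ℝ) 1 := (tilted_absolutelyContinuous μ f).ae_le h
  exact integral_nonneg_of_ae (h2.mono fun x hx => hx.1)

/-- For a probability law on `[0, 1]`, `mgf(t) ≤ e^{|t|}`. [folklore] -/
theorem mgf_id_le_exp_of_Icc {μ : Measure ℝ} [IsProbabilityMeasure μ] (hμ : μ (Set.Icc 0 1)ᶜ = 0) (t : ℝ) :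
    mgf id μ t ≤ Real.exp |t| := by
  have h := Literature.MathematicalPhysics.QuantumFieldTheory.Balaban1983to89.T4GenFunBounds.mgf_le_of_abs_le
    (ae_abs_le_one_of_Icc hμ) t
  rwa [probReal_univ, one_mul, mul_one] at h

/-! ## §2 Two probability laws on `[0, 1]`: cgf's close on the window, tilted means far AT AN INTERIOR SOURCE -/

/-- **★ CGF's `e^{l₀}ε`-CLOSE ON THE WINDOW, TILTED MEANS `e^{−l₀}(M∕(32√(l₀² − s²)) − 1)·ε` APART AT THE SOURCE `s`** (`0 < l₀`, `|s| < l₀`, `M`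
odd with `4l₀(8 + l₀) ≤ M(l₀ − |s|)` and, if `s ≠ 0`, `4πl₀ ≤ M|s|`; two probability laws on `[0, 1]`, `2(1 + 4M∕l₀)^{−M} ≤ ε ≤ 4(l₀e^{l₀}∕M)^M`) —
module 2's weights through p510514's `exists_lawPair_of_weights`: with `Z = mgf(s)`, `A = ∫x e^{sx}`, `D = A_ν − A_μ`, `ζ = Z_ν − Z_μ` one has
`Z_ν·ΔtiltedMean(s) = D − ζ·(A_μ∕Z_μ)`, `|ζ| ≤ ε`, `0 ≤ A_μ∕Z_μ ≤ 1`, `|D| ≥ ε·M∕(32√(l₀² − s²))`, `Z_ν ≤ e^{l₀}`. [folklore] -/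
theorem exists_cgf_close_tiltedMeans_far_interior {l₀ s : ℝ} (hl₀ : 0 < l₀) (hs : |s| < l₀) {M : ℕ} (hM : Odd M)
    (hM₁ : 4 * l₀ * (8 + l₀) ≤ M * (l₀ - |s|)) (hM₂ : s ≠ 0 → 4 * π * l₀ ≤ M * |s|) :
    ∃ μ ν : Measure ℝ, IsProbabilityMeasure μ ∧ IsProbabilityMeasure ν ∧
      μ (Set.Icc 0 1)ᶜ = 0 ∧ ν (Set.Icc 0 1)ᶜ = 0 ∧
      ∃ ε : ℝ, 0 < ε ∧ 2 / (1 + 4 * M / l₀) ^ M ≤ ε ∧ ε ≤ 4 * (l₀ * Real.exp l₀ / M) ^ M ∧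
        (∀ t : ℝ, |t| ≤ l₀ → |cgf id ν t - cgf id μ t| ≤ Real.exp l₀ * ε) ∧
        Real.exp (-l₀) * (((M : ℝ) / (32 * Real.sqrt (l₀ ^ 2 - s ^ 2)) - 1) * ε) ≤
          |tiltedMean id ν s - tiltedMean id μ s| := by
  obtain ⟨w, ε, hε, h0, h2, hlo, hhi, hwin, hder⟩ := exists_expsum_witness_interior hl₀ hs hM hM₁ hM₂
  obtain ⟨μ, ν, iμ, iν, hμ, hν, hg⟩ := exists_lawPair_of_weights w h0 h2
  have hmgf : ∀ t : ℝ, mgf id ν t - mgf id μ t = ∑ j ∈ range (M + 1), w j * Real.exp (t * j / M) := by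
    intro t
    simp only [mgf, id]
    rw [hg fun x => Real.exp (t * x)]
    exact sum_congr rfl fun j _ => by rw [mul_div_assoc]
  refine ⟨μ, ν, iμ, iν, hμ, hν, ε, hε, hlo, hhi, fun t ht => ?_, ?_⟩
  · have hm : 0 < Real.exp (-l₀) := Real.exp_pos _
    calc |cgf id ν t - cgf id μ t| ≤ |mgf id ν t - mgf id μ t| / Real.exp (-l₀) :=
          abs_log_sub_log_le hm (exp_neg_le_mgf_of_Icc hν ht) (exp_neg_le_mgf_of_Icc hμ ht)
      _ ≤ ε / Real.exp (-l₀) := div_le_div_of_nonneg_right (by rw [hmgf]; exact hwin t ht) hm.le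
      _ = Real.exp l₀ * ε := by rw [Real.exp_neg, div_inv_eq_mul, mul_comm]
  · -- partition functions and tilted first moments at the source `s`
    have hsl : |s| ≤ l₀ := hs.le
    have hintμ : Integrable (fun x : ℝ => Real.exp (s * x)) μ :=
      Literature.MathematicalPhysics.QuantumFieldTheory.Balaban1983to89.T4GenFunBounds.integrable_exp_mul_of_bound
        aemeasurable_id (ae_abs_le_one_of_Icc hμ) s
    have hintν : Integrable (fun x : ℝ => Real.exp (s * x)) ν :=
      Literature.MathematicalPhysics.QuantumFieldTheory.Balaban1983to89.T4GenFunBounds.integrable_exp_mul_of_bound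
        aemeasurable_id (ae_abs_le_one_of_Icc hν) s
    haveI : IsProbabilityMeasure (μ.tilted fun x : ℝ => s * x) := isProbabilityMeasure_tilted hintμ
    haveI : IsProbabilityMeasure (ν.tilted fun x : ℝ => s * x) := isProbabilityMeasure_tilted hintν
    set Zμ : ℝ := ∫ x, Real.exp (s * x) ∂μ with hZμ
    set Zν : ℝ := ∫ x, Real.exp (s * x) ∂ν with hZν
    set Aμ : ℝ := ∫ x, Real.exp (s * x) * x ∂μ with hAμ
    set Aν : ℝ := ∫ x, Real.exp (s * x) * x ∂ν with hAν
    have hZμ_eq : Zμ = mgf id μ s := by simp [hZμ, mgf]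
    have hZν_eq : Zν = mgf id ν s := by simp [hZν, mgf]
    have hZμ1 : 0 < Zμ := by rw [hZμ_eq]; exact (Real.exp_pos _).trans_le (exp_neg_le_mgf_of_Icc hμ hsl)
    have hZν0 : 0 < Zν := by rw [hZν_eq]; exact (Real.exp_pos _).trans_le (exp_neg_le_mgf_of_Icc hν hsl)
    have hZνe : Zν ≤ Real.exp l₀ := by
      rw [hZν_eq]; exact (mgf_id_le_exp_of_Icc hν s).trans (Real.exp_le_exp.2 hsl)
    have htm : ∀ (ρ : Measure ℝ), tiltedMean id ρ s = (∫ x, Real.exp (s * x) * x ∂ρ) / ∫ x, Real.exp (s * x) ∂ρ := by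
      intro ρ
      simp only [tiltedMean, id, integral_tilted, smul_eq_mul]
      rw [← integral_div]
      exact integral_congr_ae (ae_of_all _ fun x => by ring)
    have htμ : tiltedMean id μ s = Aμ / Zμ := htm μ
    have htν : tiltedMean id ν s = Aν / Zν := htm ν
    -- `ζ = Z_ν − Z_μ`, `|ζ| ≤ ε`
    have hZ : Zν - Zμ = ∑ j ∈ range (M + 1), w j * Real.exp (s * j / M) := by
      rw [hZν, hZμ, hg fun x => Real.exp (s * x)]
      exact sum_congr rfl fun j _ => by rw [mul_div_assoc]
    have hζ : |Zν - Zμ| ≤ ε := by rw [hZ]; exact hwin s hsl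
    -- `D = A_ν − A_μ`, `|D| ≥ εM/(32√(l₀²−s²))`
    have hA : Aν - Aμ = ∑ j ∈ range (M + 1), w j * (j / M) * Real.exp (s * j / M) := by
      rw [hAν, hAμ, hg fun x => Real.exp (s * x) * x]
      refine sum_congr rfl fun j _ => ?_
      rw [mul_div_assoc]; ring
    have hD : ε * ((M : ℝ) / (32 * Real.sqrt (l₀ ^ 2 - s ^ 2))) ≤ |Aν - Aμ| := by rw [hA]; exact hder
    -- `0 ≤ A_μ/Z_μ ≤ 1`
    have htμ1 : Aμ / Zμ ≤ 1 := by
      rw [← htμ, show tiltedMean id μ s = ∫ x, x ∂(μ.tilted fun x : ℝ => s * x) from rfl]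
      exact integral_id_tilted_le_one hμ _
    have htμ0 : 0 ≤ Aμ / Zμ := by
      rw [← htμ, show tiltedMean id μ s = ∫ x, x ∂(μ.tilted fun x : ℝ => s * x) from rfl]
      exact integral_id_tilted_nonneg hμ _
    -- `Z_ν·Δ = D − ζ·(A_μ/Z_μ)`
    have hΔ : Zν * (Aν / Zν - Aμ / Zμ) = (Aν - Aμ) - (Zν - Zμ) * (Aμ / Zμ) := by
      field_simp
      ring
    have hprod : |(Zν - Zμ) * (Aμ / Zμ)| ≤ ε := by
      rw [abs_mul, abs_of_nonneg htμ0]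
      calc |Zν - Zμ| * (Aμ / Zμ) ≤ ε * 1 := mul_le_mul hζ htμ1 htμ0 hε.le
        _ = ε := mul_one ε
    have hnum : ((M : ℝ) / (32 * Real.sqrt (l₀ ^ 2 - s ^ 2)) - 1) * ε ≤ Zν * |Aν / Zν - Aμ / Zμ| := by
      have e : Zν * |Aν / Zν - Aμ / Zμ| = |Zν * (Aν / Zν - Aμ / Zμ)| := by rw [abs_mul, abs_of_pos hZν0]
      rw [e, hΔ]
      have h1 := abs_sub_abs_le_abs_sub (Aν - Aμ) ((Zν - Zμ) * (Aμ / Zμ))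
      linarith
    rw [htν, htμ]
    rcases le_or_gt 0 (((M : ℝ) / (32 * Real.sqrt (l₀ ^ 2 - s ^ 2)) - 1) * ε) with hnn | hneg
    · calc Real.exp (-l₀) * ((((M : ℝ) / (32 * Real.sqrt (l₀ ^ 2 - s ^ 2))) - 1) * ε)
          ≤ Zν⁻¹ * (Zν * |Aν / Zν - Aμ / Zμ|) := by
            refine mul_le_mul ?_ hnum hnn (inv_nonneg.2 hZν0.le)
            rw [Real.exp_neg]
            exact inv_anti₀ hZν0 hZνe
        _ = |Aν / Zν - Aμ / Zμ| := by rw [← mul_assoc, inv_mul_cancel₀ hZν0.ne', one_mul]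
    · exact le_trans (mul_nonpos_iff.2 (Or.inl ⟨(Real.exp_pos _).le, hneg.le⟩)) (abs_nonneg _)

/-! ## §3 The two-sided statement at an interior source -/

set_option maxHeartbeats 400000 in
/-- **★★ THE INTERIOR PRICE IS EXACTLY BERNSTEIN's `P(ε)∕√(l₀² − s²)`, `P(ε) = ε·(1 + log⁺ε⁻¹)∕log(e + log⁺ε⁻¹)` (two-sided, arbitrarily small `ε`,
constants free of `s`).**  For every window `0 < l₀`, every interior source `|s| < l₀` and every `ε₀ > 0`: two probability laws `μ, ν` on `[0, 1]` and
`0 < ε ≤ ε₀` with cgf's `ε`-close on `|t| ≤ l₀` and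
`c(l₀)·P(ε)∕√(l₀² − s²) ≤ |tiltedMean id ν s − tiltedMean id μ s| ≤ C(l₀)·P(ε)∕√(l₀² − s²)`, `c(l₀) = e^{−2l₀}∕(64·(4 + log(1 + 4∕l₀)))`,
`C(l₀) = 16e^{1+2e·l₀}` — lower half §2 at a large odd `M` (p517472's `one_add_le_mul_log_of_le`), upper half p528923's
`abs_tiltedMean_sub_le_sharp_of_cgf_close` at `B = 1`, `c = 0` (valid for EVERY such pair) + p530176's `log` trade.  Bernstein's `n∕√(1 − x²)` is the truth
inside the window. [folklore] -/
theorem interior_price_two_sided {l₀ s : ℝ} (hl₀ : 0 < l₀) (hs : |s| < l₀) {ε₀ : ℝ} (hε₀ : 0 < ε₀) :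
    ∃ μ ν : Measure ℝ, IsProbabilityMeasure μ ∧ IsProbabilityMeasure ν ∧
      μ (Set.Icc 0 1)ᶜ = 0 ∧ ν (Set.Icc 0 1)ᶜ = 0 ∧
      ∃ ε : ℝ, 0 < ε ∧ ε ≤ ε₀ ∧ (∀ t : ℝ, |t| ≤ l₀ → |cgf id ν t - cgf id μ t| ≤ ε) ∧
        Real.exp (-2 * l₀) / (64 * (4 + Real.log (1 + 4 / l₀))) *
            (ε * (1 + Real.posLog ε⁻¹) / Real.log (Real.exp 1 + Real.posLog ε⁻¹)) / Real.sqrt (l₀ ^ 2 - s ^ 2) ≤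
          |tiltedMean id ν s - tiltedMean id μ s| ∧
        |tiltedMean id ν s - tiltedMean id μ s| ≤
          16 * Real.exp (1 + 2 * Real.exp 1 * l₀) *
            (ε * (1 + Real.posLog ε⁻¹) / Real.log (Real.exp 1 + Real.posLog ε⁻¹)) / Real.sqrt (l₀ ^ 2 - s ^ 2) := by
  have hs0 : 0 ≤ |s| := abs_nonneg s
  have hls : 0 < l₀ - |s| := sub_pos.2 hs
  have hsqrt0 : 0 < Real.sqrt (l₀ ^ 2 - s ^ 2) := Real.sqrt_pos.2 (by have := sq_abs s; nlinarith)
  have hsqrtle : Real.sqrt (l₀ ^ 2 - s ^ 2) ≤ l₀ := by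
    rw [Real.sqrt_le_left hl₀.le]; nlinarith [sq_nonneg s]
  set a : ℝ := l₀ * Real.exp l₀ with ha
  have ha0 : 0 < a := by positivity
  -- a large odd `M = 2k + 1`
  obtain ⟨k, hk⟩ := exists_nat_gt (max (max (max a (4 * a * Real.exp l₀ / ε₀)) (4 * l₀ * (8 + l₀) / (l₀ - |s|)))
    (max (4 * π * l₀ / |s|) (64 * l₀)))
  have hka : a < k := ((le_max_left _ _).trans ((le_max_left _ _).trans (le_max_left _ _))).trans_lt hk
  have hkε : 4 * a * Real.exp l₀ / ε₀ < k :=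
    ((le_max_right _ _).trans ((le_max_left _ _).trans (le_max_left _ _))).trans_lt hk
  have hk₁ : 4 * l₀ * (8 + l₀) / (l₀ - |s|) < k := ((le_max_right _ _).trans (le_max_left _ _)).trans_lt hk
  have hk₂ : 4 * π * l₀ / |s| < k := ((le_max_left _ _).trans (le_max_right _ _)).trans_lt hk
  have hk64 : 64 * l₀ < k := ((le_max_right _ _).trans (le_max_right _ _)).trans_lt hk
  have hk0 : (0 : ℝ) < k := ha0.trans hka
  set M : ℕ := 2 * k + 1 with hMdef
  have hModd : Odd M := odd_two_mul_add_one k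
  have hMk : (k : ℝ) < M := by rw [hMdef]; push_cast; linarith
  have hM0 : (0 : ℝ) < M := hk0.trans hMk
  have hM₁ : 4 * l₀ * (8 + l₀) ≤ M * (l₀ - |s|) := by
    have := (div_lt_iff₀ hls).1 hk₁
    nlinarith
  have hM₂ : s ≠ 0 → 4 * π * l₀ ≤ M * |s| := fun hsne => by
    have hsa : 0 < |s| := abs_pos.2 hsne
    have := (div_lt_iff₀ hsa).1 hk₂
    nlinarith
  obtain ⟨μ, ν, iμ, iν, hμ, hν, ε, hε, hlo, hhi, hwin, hlow⟩ :=
    exists_cgf_close_tiltedMeans_far_interior hl₀ hs hModd hM₁ hM₂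
  set ε' : ℝ := Real.exp l₀ * ε with hε'
  have hε'0 : 0 < ε' := by positivity
  have hb0 : 0 ≤ a / M := div_nonneg ha0.le hM0.le
  have hb1 : a / M ≤ 1 := by rw [div_le_one hM0]; linarith
  have hεsmall : ε' ≤ ε₀ := by
    have h1 : (a / M) ^ M ≤ a / M :=
      (pow_le_pow_of_le_one hb0 hb1 (by exact_mod_cast hModd.pos)).trans (pow_one _).le
    have h2 : ε' ≤ 4 * a * Real.exp l₀ / M :=
      calc ε' ≤ Real.exp l₀ * (4 * (a / M) ^ M) := by rw [hε', ha]; gcongr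
        _ ≤ Real.exp l₀ * (4 * (a / M)) := by gcongr
        _ = 4 * a * Real.exp l₀ / M := by ring
    have h3 : 4 * a * Real.exp l₀ / M ≤ 4 * a * Real.exp l₀ / k :=
      div_le_div_of_nonneg_left (by positivity) hk0 hMk.le
    have h4 : 4 * a * Real.exp l₀ / k < ε₀ := by
      rw [div_lt_iff₀ hk0]
      have := (div_lt_iff₀ hε₀).1 hkε
      linarith
    linarith
  refine ⟨μ, ν, iμ, iν, hμ, hν, ε', hε'0, hεsmall, hwin, ?_, ?_⟩
  · -- LOWER: `(K − 1)ε ≥ (K/2)ε` for `K = M/(32√(l₀²−s²)) ≥ 2`, then `log⁺ε′⁻¹ ≤ M·log(1 + 4M/l₀)` and p517472's arithmetic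
    set L := Real.posLog ε'⁻¹ with hL
    have hL0 : 0 ≤ L := Real.posLog_nonneg
    have hbase : 1 ≤ 1 + 4 * (M : ℝ) / l₀ := by linarith [show 0 ≤ 4 * (M : ℝ) / l₀ by positivity]
    have hpow1 : 1 ≤ (1 + 4 * (M : ℝ) / l₀) ^ M := one_le_pow₀ hbase
    have hinv : ε'⁻¹ ≤ (1 + 4 * (M : ℝ) / l₀) ^ M := by
      rw [inv_le_comm₀ hε'0 (by positivity)]
      calc ((1 + 4 * (M : ℝ) / l₀) ^ M)⁻¹ = 1 * (1 / (1 + 4 * (M : ℝ) / l₀) ^ M) := by rw [one_mul, one_div]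
        _ ≤ Real.exp l₀ * (2 / (1 + 4 * (M : ℝ) / l₀) ^ M) := by
            gcongr
            · exact Real.one_le_exp hl₀.le
            · norm_num
        _ ≤ ε' := by rw [hε']; gcongr
    have hLle : L ≤ M * Real.log (1 + 4 * M / l₀) := by
      calc L = Real.posLog ε'⁻¹ := hL
        _ ≤ Real.posLog ((1 + 4 * (M : ℝ) / l₀) ^ M) :=
            Real.monotoneOn_posLog (Set.mem_Ici.2 (inv_nonneg.2 hε'0.le)) (Set.mem_Ici.2 (by positivity)) hinv
        _ = Real.log ((1 + 4 * (M : ℝ) / l₀) ^ M) := Real.posLog_eq_log (by rwa [abs_of_nonneg (by positivity)])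
        _ = M * Real.log (1 + 4 * M / l₀) := by rw [Real.log_pow]
    have harith := one_add_le_mul_log_of_le hl₀ hModd.pos hL0 hLle
    have hc : 0 < 4 + Real.log (1 + 4 / l₀) := by
      linarith [Real.log_nonneg (show (1:ℝ) ≤ 1 + 4 / l₀ by linarith [div_pos four_pos hl₀])]
    have hlogpos : 0 < Real.log (Real.exp 1 + L) := Real.log_pos (by linarith [Real.add_one_le_exp (1 : ℝ)])
    -- `K ≥ 2`
    set K : ℝ := (M : ℝ) / (32 * Real.sqrt (l₀ ^ 2 - s ^ 2)) with hK
    have hK2 : 2 ≤ K := by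
      rw [hK, le_div_iff₀ (by positivity)]
      nlinarith [hMk, hk64, hsqrtle]
    have hhalf : K / 2 * ε ≤ (K - 1) * ε := mul_le_mul_of_nonneg_right (by linarith) hε.le
    generalize hcdef : 4 + Real.log (1 + 4 / l₀) = c at hc harith
    generalize hgdef : Real.log (Real.exp 1 + L) = g at hlogpos harith
    have h1L : 0 ≤ 1 + L := by linarith
    -- `M ≥ (1 + L)/(c g)`
    have hMge : (1 + L) / (c * g) ≤ M := by
      rw [div_le_iff₀ (mul_pos hc hlogpos)]; linarith
    calc Real.exp (-2 * l₀) / (64 * c) * (ε' * (1 + L) / g) / Real.sqrt (l₀ ^ 2 - s ^ 2)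
        = Real.exp (-2 * l₀) * ε' / (64 * Real.sqrt (l₀ ^ 2 - s ^ 2)) * ((1 + L) / (c * g)) := by
          field_simp
      _ ≤ Real.exp (-2 * l₀) * ε' / (64 * Real.sqrt (l₀ ^ 2 - s ^ 2)) * M := by gcongr
      _ = Real.exp (-l₀) * (K / 2 * ε) := by
          rw [hε', hK, show (-2 : ℝ) * l₀ = -l₀ + -l₀ by ring, Real.exp_add, Real.exp_neg l₀]
          field_simp
          ring
      _ ≤ Real.exp (-l₀) * ((K - 1) * ε) := mul_le_mul_of_nonneg_left hhalf (Real.exp_pos _).le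
      _ ≤ _ := hlow
  · -- UPPER: p528923 at `B = 1`, `c = 0`, then `e^{e|s|} ≤ e^{e l₀}`, `log⁺(2ε′)⁻¹ ≤ log⁺ε′⁻¹` and p530176's `log` trade
    have hwin0 : ∀ u : ℝ, |u| ≤ l₀ → |cgf id ν u - cgf id μ u - 0| ≤ ε' := fun u hu => by rw [sub_zero]; exact hwin u hu
    have hup := abs_tiltedMean_sub_le_sharp_of_cgf_close (ν := μ) (ν' := ν) (F := id) (F' := id) (B := 1) aemeasurable_id
      (ae_abs_le_one_of_Icc hμ) aemeasurable_id (ae_abs_le_one_of_Icc hν) hε'0.le hwin0 hs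
    refine hup.trans ?_
    set L := Real.posLog ε'⁻¹ with hL
    set L₂ := Real.posLog (2 * ε')⁻¹ with hL₂
    have hL0 : 0 ≤ L := Real.posLog_nonneg
    have hL₂0 : 0 ≤ L₂ := Real.posLog_nonneg
    have hL₂L : L₂ ≤ L :=
      Real.monotoneOn_posLog (Set.mem_Ici.2 (by positivity)) (Set.mem_Ici.2 (by positivity)) (inv_anti₀ hε'0 (by linarith))
    have hg₂ : 0 < Real.log (Real.exp 1 + L₂) := Real.log_pos (by linarith [Real.add_one_le_exp (1 : ℝ)])
    have htrade : Real.log (Real.exp 1 + L) ≤ 2 * Real.log (Real.exp 1 + L₂) := log_exp_one_add_posLog_le_two_mul hε'0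
    have hg : 0 < Real.log (Real.exp 1 + L) := Real.log_pos (by linarith [Real.add_one_le_exp (1 : ℝ)])
    have hexp : Real.exp (1 + Real.exp 1 * (l₀ + |s|) * 1) ≤ Real.exp (1 + 2 * Real.exp 1 * l₀) := by
      refine Real.exp_le_exp.2 ?_
      nlinarith [Real.exp_pos (1 : ℝ), hs.le]
    have hinvlog : 1 / Real.log (Real.exp 1 + L₂) ≤ 2 / Real.log (Real.exp 1 + L) := by
      rw [div_le_div_iff₀ hg₂ hg, one_mul]
      linarith
    calc 8 * Real.exp (1 + Real.exp 1 * (l₀ + |s|) * 1) * ε' * (1 + L₂) / (Real.sqrt (l₀ ^ 2 - s ^ 2) * Real.log (Real.exp 1 + L₂))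
        = 8 * Real.exp (1 + Real.exp 1 * (l₀ + |s|) * 1) * ε' * (1 + L₂) * (1 / Real.log (Real.exp 1 + L₂)) /
            Real.sqrt (l₀ ^ 2 - s ^ 2) := by
          rw [mul_comm (Real.sqrt _) _, ← div_div, div_eq_mul_one_div _ (Real.log _)]
      _ ≤ 8 * Real.exp (1 + 2 * Real.exp 1 * l₀) * ε' * (1 + L) * (2 / Real.log (Real.exp 1 + L)) /
            Real.sqrt (l₀ ^ 2 - s ^ 2) := by
          gcongr
      _ = 16 * Real.exp (1 + 2 * Real.exp 1 * l₀) * (ε' * (1 + L) / Real.log (Real.exp 1 + L)) / Real.sqrt (l₀ ^ 2 - s ^ 2) := by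
          ring

end Summit.QuantumFields.YangMills.Theorems.BalabanUVNodesN19TiltedPriceInteriorTwoSided

end
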